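import Literature.AlgebraicGeometry.Modules.StrictlyPerfectResolutionExists
import Literature.AlgebraicGeometry.Modules.StrictlyPerfectResolutionOfRegularNoetherian
import Literature.AlgebraicGeometry.Modules.ResolutionPropertyOfRegular
import HarnessLib

/-!
# Discharge of the named fact `Hartshorne1977_exists_strictlyPerfectResolution` (Hartshorne III Ex. 6.8 + 6.9 (a))

Layer `Literature/AlgebraicGeometry/Modules`. The named fact
`Modules/StrictlyPerfectResolutionExists.Hartshorne1977_exists_strictlyPerfectResolution` — on a noetherian,
integral, separated, regular scheme every coherent sheaf has a finite locally free resolution (Hartshorne III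
Ex. 6.9 (a) with Ex. 6.8; Fulton App. B.8.3 (i)–(ii)) — is PROVED, literally as typed (no dimension bound, no
base field), as the composition of two tree theorems:

* Kleiman's theorem `Modules/ResolutionPropertyOfRegular.exists_isFiniteLocallyFree_epi_of_coh_of_isRegular`
  (Hartshorne II Ex. 6.8: the resolution property of a noetherian integral separated scheme with regular local
  rings — the complement of an affine open is an effective Cartier divisor by Auslander–Buchsbaum, Görtz–Wedhorn
  II Lemma 25.150, and sections extend along Deligne homomorphisms `𝓘ⁿ𝒪_X ⟶ F`), and
* termination `Modules/StrictlyPerfectResolutionOfRegularNoetherian.nonempty_strictlyPerfectResolution_of_coh_of_isRegular_of_isNoetherian`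
  (Hartshorne III Ex. 6.9 (a): syzygies are eventually locally free — over a regular ring every finite module has
  FINITE projective dimension, Görtz–Wedhorn II Prop. G.5, so that no bound on the Krull dimension is needed).

One theorem, no definitions, no instances; no consumer of the fact is edited (they are fed by name).

## References

* R. Hartshorne, *Algebraic Geometry*, GTM 52 (1977), II Ex. 6.8 (p. 149), III Ex. 6.8, Ex. 6.9 (a) (p. 238).
  [Hartshorne1977]
* W. Fulton, *Intersection Theory*, 2nd ed. (1998), App. B.8.3 (i)–(ii). [Fulton1998]
* U. Görtz, T. Wedhorn, *Algebraic Geometry II* (2023), Lemma 25.150, Prop. 23.55, Prop. G.5. [GortzWedhorn2023]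
-/

noncomputable section

universe u

open CategoryTheory AlgebraicGeometry

namespace Literature.AlgebraicGeometry.Modules

open Literature.AlgebraicGeometry.Resolution

/-- **Hartshorne III Ex. 6.9 (a) (with Ex. 6.8) holds**: on a noetherian, integral, separated, regular scheme
every coherent `𝒪_X`-module has a strictly perfect resolution — the named fact
`Hartshorne1977_exists_strictlyPerfectResolution`, discharged by Kleiman's resolution property
(`exists_isFiniteLocallyFree_epi_of_coh_of_isRegular`) and the dimension-free termination on noetherian regular
schemes (`nonempty_strictlyPerfectResolution_of_coh_of_isRegular_of_isNoetherian`).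
[cite: Hartshorne1977, III Ex. 6.9 (a) and Ex. 6.8 (p. 238)] [cite: Fulton1998, App. B.8.3 (i)–(ii)]
[cite: GortzWedhorn2023, Lemma 25.150 and Prop. 23.55] -/
theorem Hartshorne1977_exists_strictlyPerfectResolution_holds :
    Hartshorne1977_exists_strictlyPerfectResolution.{u} := by
  intro X _ _ _ hreg F hF
  exact nonempty_strictlyPerfectResolution_of_coh_of_isRegular_of_isNoetherian
    (fun G hG => exists_isFiniteLocallyFree_epi_of_coh_of_isRegular hreg hG) hreg hF

end Literature.AlgebraicGeometry.Modules

end
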